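import Summits.Ventures.GridStability.Models.WSCC9SPSlab
import Summits.Ventures.GridStability.Lyapunov.WSCC9SP9SlabData

/-!
# GridStability/Bench/WSCC9SP9SlabRoa — THE SP-LANE CANARY «G2.b-SP9-SLAB»: a kernel-checked
# Lur'e–Postnikov SLAB (S-procedure + POPOV) certificate for the structure-preserving WSCC 3-machine
# model relative to bus 9, and its certified region

Cell `gridfusion` (LADDER-GRIDFUSION), SP–Lur'e lane; lead RULING R-SP9-ROW AMENDMENT 2026-08-27T05:42:24Z
(«model-2 carries the canary end to end»); seat gridfusion-model-2 (g6). **CANARY, NOT OF RECORD.**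

OBJECT: `WSCC9SP.relLurie D` (Models/WSCC9SPLurie.lean p498695: the 9-node structure-preserving WSCC
instance post-fault network B, column V1, relative to bus 9; 11 states `Fin 8 ⊕ Fin 3`, 8 lines) for the
DECLARED damping vector `D = DQ` (machines `(1/10, 1/5, 3/10)·M` = S&P Ex. 7.1 ratios transplanted —
MV-SPD; buses `1/10` SYNTHETIC). DATA: `Lyapunov/WSCC9SP9SlabData.lean` (kit j269890, exact dyadic
certificate + two integer Gram certificates, kernel-decided).
WHAT IS PROVED: (1) the relative system's matrices are the casts of explicit rational matrices
(`A_eq`, `B_eq`, `C_eq` — structural, four cases each); (2) the slab blocks computed over `ℚ` from those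
matrices and the certificate data EQUAL the decided `M2q` (`slabQ_eq`, one kernel `decide`);
(3) hence `cert : SlabCertificate (WSCC9SP.relLurie D)` — lit-6's structure [cite: Pai1981, §2.16 Theorem [18] eqs. (2.63)–(2.64)]
with `P − ε·1 ⪰ 0` and `−slabMatrix ⪰ 0` from the integer Gram certificates; (4) `sp9_slab_roa` =
`WSCC9SP.slab_roa_of_eps` (p500745) applied with `u = 1/4`, `γ_lo = 97/200`, `c = cQ`: **for MODEL
M′_D = `(WSCC9SP.params D).phaseField`: from every phase point whose 8 listed line-angle deviations satisfy
`|σ_e − σ*_e| ≤ 97/200` and whose relative state has `V ≤ cQ` (`V = xᵀPx + 2Σ λ_e∫F_e`), a solution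
exists and EVERY solution keeps `|σ_e(t) − σ*_e| < 2·atan(1/4)` (≈ 28.07°) and `V ≤ cQ` for all `t ≥ 0`,
every bus-angle difference tends to the equilibrium's, every machine frequency deviation tends to `0`.**
THREE COLUMNS. CERTIFIED: (3)–(4) for MODEL M′_D, CLASS = slab `u = 1/4`, `γ_lo = 97/200`, level
`cQ = 366951/655360000`. MODELLED: «MV-3 + lossless + MV-RD(0.046 @ slack G1) + D⟨declared: MV-SPD
transplant machines, buses 1/10 synthetic⟩ + V-frozen(V1) + ω_R = 377 printed + ref bus 9; canary NOT
of record — a structure-preserving VARIANT of the printed 9-bus, not a 9-bus sentence». VALIDATED: the SDP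
solve (CLARABEL), the region datum (inner relative-state ball ≈ 0.5° at the ε-level; slab 28°) — the
level is feasibility-grade, not optimised. Nothing here says the WSCC system or any grid is stable.
-/

noncomputable section

open Set Filter Topology Real Matrix
open Literature.MathematicalPhysics.PowerSystems
open Literature.MathematicalPhysics.PowerSystems.LyapunovFunctionFamily
open Literature.Computation.Certificates
open Summit.Ventures.GridStability.Models
open Summit.Ventures.GridStability.Models.StructurePreserving
open Summit.Ventures.GridStability.Models.WSCC9SP
open Summit.Ventures.GridStability.Lyapunov.WSCC9SP9Slab

namespace Summit.Ventures.GridStability.Bench.WSCC9SP9Slab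

/-! ### The declared damping vector and the object -/

/-- The DECLARED damping / load-frequency vector over `ℝ`. -/
def D : Fin 9 → ℝ := fun v => (DQ v : ℝ)

/-- `D > 0`. -/
theorem hD : ∀ v, 0 < D v := fun v => by unfold D; exact_mod_cast DQ_pos v

/-- State index flattening `Fin 8 ⊕ Fin 3 ≃ Fin 11`. -/
def e1 : Fin 8 ⊕ Fin 3 ≃ Fin 11 := finSumFinEquiv

/-- Certificate-matrix index flattening `(Fin 8 ⊕ Fin 3) ⊕ Fin 8 ≃ Fin 19`. -/
def e2 : (Fin 8 ⊕ Fin 3) ⊕ Fin 8 ≃ Fin 19 :=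
  (Equiv.sumCongr finSumFinEquiv (Equiv.refl (Fin 8))).trans finSumFinEquiv

/-! ### The relative system's matrices as casts of rational matrices -/

/-- Incidence numbers over `ℚ`. -/
def edgeIncQ (e : Fin 8) (v : Fin 9) : ℚ :=
  (if srcV e = v then 1 else 0) - (if tgtV e = v then 1 else 0)

/-- `A` over `ℚ` (same shape as `Params.relA`). -/
def AQ : Matrix (Fin 8 ⊕ Fin 3) (Fin 8 ⊕ Fin 3) ℚ
  | Sum.inl _, Sum.inl _ => 0
  | Sum.inl i, Sum.inr j => if ref.succAbove i = gnode j then 1 else 0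
  | Sum.inr _, Sum.inl _ => 0
  | Sum.inr j, Sum.inr j' => if j = j' then -(DQ (gnode j) / MQ (gnode j)) else 0

/-- `B` over `ℚ` (same shape as `Params.relB`). -/
def BQ : Matrix (Fin 8 ⊕ Fin 3) (Fin 8) ℚ
  | Sum.inl i, e => ((if ref.succAbove i ∈ genS then 0
      else edgeIncQ e (ref.succAbove i) / DQ (ref.succAbove i)) - edgeIncQ e ref / DQ ref) * wtV1Q e
  | Sum.inr j, e => edgeIncQ e (gnode j) / MQ (gnode j) * wtV1Q e

/-- `C` over `ℚ` (same shape as `Params.relC`). -/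
def CQ : Matrix (Fin 8) (Fin 8 ⊕ Fin 3) ℚ
  | e, Sum.inl i => edgeIncQ e (ref.succAbove i)
  | _, Sum.inr _ => 0

/-- Incidence numbers are casts. -/
theorem edgeInc_eq (e : Fin 8) (v : Fin 9) :
    edgeInc srcV tgtV e v = ((edgeIncQ e v : ℚ) : ℝ) := by
  unfold edgeInc edgeIncQ
  split_ifs <;> norm_num

/-- `A = AQ ↦ ℝ`. -/
theorem A_eq : (WSCC9SP.relLurie D).A = AQ.map (Rat.cast : ℚ → ℝ) := by
  ext a b
  rcases a with i | j <;> rcases b with i' | j'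
  · simp [WSCC9SP.relLurie, Params.relLurie, Params.relA, AQ]
  · by_cases h : ref.succAbove i = gnode j'
    · simp [WSCC9SP.relLurie, Params.relLurie, Params.relA, AQ, h]
    · simp [WSCC9SP.relLurie, Params.relLurie, Params.relA, AQ, h]
  · simp [WSCC9SP.relLurie, Params.relLurie, Params.relA, AQ]
  · by_cases h : j = j'
    · subst h
      simp [WSCC9SP.relLurie, Params.relLurie, Params.relA, AQ, WSCC9SP.params, D]
    · simp [WSCC9SP.relLurie, Params.relLurie, Params.relA, AQ, h]

/-- `B = BQ ↦ ℝ`. -/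
theorem B_eq : (WSCC9SP.relLurie D).B = BQ.map (Rat.cast : ℚ → ℝ) := by
  ext a e
  rcases a with i | j
  · by_cases h : ref.succAbove i ∈ genS
    · simp [WSCC9SP.relLurie, Params.relLurie, Params.relB, BQ, WSCC9SP.params, h, D, wt,
        edgeInc_eq]
    · simp [WSCC9SP.relLurie, Params.relLurie, Params.relB, BQ, WSCC9SP.params, h, D, wt,
        edgeInc_eq]
  · simp [WSCC9SP.relLurie, Params.relLurie, Params.relB, BQ, WSCC9SP.params, wt, edgeInc_eq]

/-- `C = CQ ↦ ℝ`. -/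
theorem C_eq : (WSCC9SP.relLurie D).C = CQ.map (Rat.cast : ℚ → ℝ) := by
  ext e b
  rcases b with i | j
  · simp [WSCC9SP.relLurie, Params.relLurie, Params.relC, CQ, edgeInc_eq]
  · simp [WSCC9SP.relLurie, Params.relLurie, Params.relC, CQ]

/-! ### The slab blocks over `ℚ` and the decided identity with `M2q` -/

/-- `P` over `ℚ`, reindexed to the state type. -/
def PQ : Matrix (Fin 8 ⊕ Fin 3) (Fin 8 ⊕ Fin 3) ℚ := Pq.submatrix e1 e1

/-- `τ_e·a_e·b_e` with `a_e = 7/10`, `b_e = 1`. -/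
def tabQ : Fin 8 → ℚ := fun e => tauQ e * (aQ * 1)

/-- `τ_e·(a_e + b_e)/2`. -/
def tab2Q : Fin 8 → ℚ := fun e => tauQ e * (aQ + 1) / 2

/-- State block over `ℚ`: `AᵀP + PA + η·1 − Cᵀ·diag(τab)·C`. -/
def L11Q : Matrix (Fin 8 ⊕ Fin 3) (Fin 8 ⊕ Fin 3) ℚ :=
  AQᵀ * PQ + PQ * AQ + etaQ • (1 : Matrix (Fin 8 ⊕ Fin 3) (Fin 8 ⊕ Fin 3) ℚ)
    - CQᵀ * Matrix.diagonal tabQ * CQ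

/-- Cross block over `ℚ`: `−PB + (CA)ᵀ·diag(λ) + Cᵀ·diag(τ(a+b)/2)`. -/
def L12Q : Matrix (Fin 8 ⊕ Fin 3) (Fin 8) ℚ :=
  -(PQ * BQ) + (CQ * AQ)ᵀ * Matrix.diagonal lamQ + CQᵀ * Matrix.diagonal tab2Q

/-- Channel block over `ℚ`: `−diag(λ)·CB − (diag(λ)·CB)ᵀ − diag τ`. -/
def L22Q : Matrix (Fin 8) (Fin 8) ℚ :=
  -(Matrix.diagonal lamQ * (CQ * BQ)) - (Matrix.diagonal lamQ * (CQ * BQ))ᵀ - Matrix.diagonal tauQ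

set_option maxHeartbeats 400000 in
/-- **The exact certificate matrix**: `−𝓛 = M2q` (reindexed), decided in the kernel over `ℚ`. -/
theorem slabQ_eq : -(Matrix.fromBlocks L11Q L12Q L12Qᵀ L22Q) = M2q.submatrix e2 e2 := by
  decide +kernel

/-- `PQ` is symmetric (kernel). -/
theorem PQ_transpose : PQᵀ = PQ := by
  decide +kernel

/-! ### The certificate data over `ℝ` -/

/-- `P` (real). -/
def P : Matrix (Fin 8 ⊕ Fin 3) (Fin 8 ⊕ Fin 3) ℝ := PQ.map (Rat.cast : ℚ → ℝ)
/-- `τ` (real). -/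
def τ : Fin 8 → ℝ := fun e => (tauQ e : ℝ)
/-- `λ` (real, Popov coefficients). -/
def lam : Fin 8 → ℝ := fun e => (lamQ e : ℝ)
/-- lower slopes `a_e = 7/10`. -/
def a : Fin 8 → ℝ := fun _ => (aQ : ℝ)
/-- upper slopes `b_e = 1`. -/
def b : Fin 8 → ℝ := fun _ => 1

/-! ### Cast plumbing -/

/-- `(M·N) ↦ ℝ` = product of the casts (plumbing). -/
private theorem map_mul' {m n o : Type*} [Fintype n] (M : Matrix m n ℚ) (N : Matrix n o ℚ) :
    (M * N).map (Rat.cast : ℚ → ℝ) = M.map (Rat.cast : ℚ → ℝ) * N.map (Rat.cast : ℚ → ℝ) :=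
  Matrix.map_mul (f := Rat.castHom ℝ)

/-- `(M+N) ↦ ℝ` = sum of the casts (plumbing). -/
private theorem map_add' {m n : Type*} (M N : Matrix m n ℚ) :
    (M + N).map (Rat.cast : ℚ → ℝ) = M.map (Rat.cast : ℚ → ℝ) + N.map (Rat.cast : ℚ → ℝ) := by
  ext i j; simp

/-- `(M−N) ↦ ℝ` = difference of the casts (plumbing). -/
private theorem map_sub' {m n : Type*} (M N : Matrix m n ℚ) :
    (M - N).map (Rat.cast : ℚ → ℝ) = M.map (Rat.cast : ℚ → ℝ) - N.map (Rat.cast : ℚ → ℝ) := by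
  ext i j; simp

/-- `(−M) ↦ ℝ` = minus the cast (plumbing). -/
private theorem map_neg' {m n : Type*} (M : Matrix m n ℚ) :
    (-M).map (Rat.cast : ℚ → ℝ) = -M.map (Rat.cast : ℚ → ℝ) := by
  ext i j; simp

/-- transpose commutes with the cast (plumbing, `rfl`). -/
private theorem map_transpose' {m n : Type*} (M : Matrix m n ℚ) :
    Mᵀ.map (Rat.cast : ℚ → ℝ) = (M.map (Rat.cast : ℚ → ℝ))ᵀ := rfl

/-- `diag(d) ↦ ℝ = diag(d ↦ ℝ)` (plumbing). -/
private theorem map_diagonal' {n : Type*} [DecidableEq n] (d : n → ℚ) :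
    (Matrix.diagonal d).map (Rat.cast : ℚ → ℝ) = Matrix.diagonal (fun i => (d i : ℝ)) :=
  Matrix.diagonal_map Rat.cast_zero

/-- `(q·1) ↦ ℝ = (q ↦ ℝ)·1` (plumbing). -/
private theorem map_smul_one' {n : Type*} [DecidableEq n] (q : ℚ) :
    (q • (1 : Matrix n n ℚ)).map (Rat.cast : ℚ → ℝ) = (q : ℝ) • (1 : Matrix n n ℝ) := by
  ext i j
  by_cases h : i = j
  · subst h; simp
  · simp [h]

/-! ### The blocks of the certificate matrix over `ℝ` are the casts -/

/-- State block. -/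
theorem L11_eq : slabL11 (WSCC9SP.relLurie D) P (etaQ : ℝ) τ a b = L11Q.map (Rat.cast : ℚ → ℝ) := by
  have hd : Matrix.diagonal (fun k => τ k * (a k * b k)) = (Matrix.diagonal tabQ).map (Rat.cast : ℚ → ℝ) := by
    rw [map_diagonal']
    congr 1; funext k; simp [τ, a, b, tabQ]
  rw [slabL11, A_eq, C_eq, hd, P, L11Q]
  simp only [map_sub', map_add', map_mul', map_transpose', map_smul_one']

/-- Cross block. -/
theorem L12_eq : slabL12 (WSCC9SP.relLurie D) P lam τ a b = L12Q.map (Rat.cast : ℚ → ℝ) := by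
  have hd1 : Matrix.diagonal lam = (Matrix.diagonal lamQ).map (Rat.cast : ℚ → ℝ) := by
    rw [map_diagonal']; rfl
  have hd2 : Matrix.diagonal (fun k => τ k * (a k + b k) / 2)
      = (Matrix.diagonal tab2Q).map (Rat.cast : ℚ → ℝ) := by
    rw [map_diagonal']
    congr 1; funext k; simp [τ, a, b, tab2Q]
  rw [slabL12, A_eq, B_eq, C_eq, hd1, hd2, P, L12Q]
  simp only [map_add', map_neg', map_mul', map_transpose']

/-- Channel block. -/
theorem L22_eq : slabL22 (WSCC9SP.relLurie D) lam τ = L22Q.map (Rat.cast : ℚ → ℝ) := by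
  have hd1 : Matrix.diagonal lam = (Matrix.diagonal lamQ).map (Rat.cast : ℚ → ℝ) := by
    rw [map_diagonal']; rfl
  have hd3 : Matrix.diagonal τ = (Matrix.diagonal tauQ).map (Rat.cast : ℚ → ℝ) := by
    rw [map_diagonal']; rfl
  rw [slabL22, B_eq, C_eq, hd1, hd3, L22Q]
  simp only [map_sub', map_neg', map_mul', map_transpose']

/-- **`−𝓛` over `ℝ` is the reindexed cast of `M2q`.** -/
theorem neg_slabMatrix_eq : -(slabMatrix (WSCC9SP.relLurie D) P (etaQ : ℝ) lam τ a b)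
    = (M2q.map (Rat.cast : ℚ → ℝ)).submatrix e2 e2 := by
  rw [slabMatrix, L11_eq, L12_eq, L22_eq, ← map_transpose', ← Matrix.fromBlocks_map, ← map_neg',
    slabQ_eq]
  rfl

/-- `P − ε·1` over `ℝ` is the reindexed cast of `Pq − epsQ·1`. -/
theorem P_sub_eq : P - (epsQ : ℝ) • (1 : Matrix (Fin 8 ⊕ Fin 3) (Fin 8 ⊕ Fin 3) ℝ)
    = ((Pq - epsQ • (1 : Matrix (Fin 11) (Fin 11) ℚ)).map (Rat.cast : ℚ → ℝ)).submatrix e1 e1 := by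
  ext i j
  by_cases h : i = j
  · subst h; simp [P, PQ]
  · have h' : e1 i ≠ e1 j := fun he => h (e1.injective he)
    simp [P, PQ, h, h']

/-! ### The certificate -/

/-- **THE CANARY SLAB CERTIFICATE** for `WSCC9SP.relLurie D`: lit-6's `SlabCertificate` with the exact
data of `WSCC9SP9SlabData` (`P`, `ε = 39/8192`, `η = 1/1000`, `τ`, `λ ≤ 1`, `a = 7/10`, `b = 1`); the two
matrix facts come from the kernel-decided integer Gram certificates. CANARY, NOT OF RECORD.
[cite: Pai1981, §2.16 Theorem [18] eqs. (2.63)–(2.64); VuTuritsyn2017, §4.2 Lemma 1] -/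
def cert : SlabCertificate (WSCC9SP.relLurie D) where
  P := P
  ε := (epsQ : ℝ)
  η := (etaQ : ℝ)
  τ := τ
  lam := lam
  a := a
  b := b
  P_symm := by
    show (PQ.map (Rat.cast : ℚ → ℝ))ᵀ = PQ.map (Rat.cast : ℚ → ℝ)
    rw [← map_transpose', PQ_transpose]
  ε_pos := by exact_mod_cast epsQ_pos
  η_pos := by exact_mod_cast etaQ_pos
  P_ge := by
    rw [P_sub_eq]
    exact (Matrix.posSemidef_submatrix_equiv e1).2 posSemidef_M1
  τ_nonneg := fun e => by unfold τ; exact_mod_cast tauQ_nonneg e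
  lam_nonneg := fun e => by unfold lam; exact_mod_cast lamQ_nonneg e
  a_nonneg_of_lam_pos := fun e _ => by unfold a aQ; norm_num
  lmi := by
    rw [neg_slabMatrix_eq]
    exact (Matrix.posSemidef_submatrix_equiv e2).2 posSemidef_M2

/-- `a_e = 7/10 ≤ slabSlope(1/4)` (= cos(θ + γ) ≈ 0.70266 exactly rational). -/
theorem a_le_slabSlope : ∀ e, cert.a e ≤ (slabSlope (1 / 4) : ℝ) := fun e => by
  show ((aQ : ℚ) : ℝ) ≤ ((slabSlope (1 / 4) : ℚ) : ℝ)
  exact_mod_cast (show aQ ≤ slabSlope (1 / 4) by norm_num [aQ, slabSlope, tauV1])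

/-- `1 ≤ b_e`. -/
theorem one_le_b : ∀ e, (1 : ℝ) ≤ cert.b e := fun _ => le_refl _

/-- The level passes the ε-test: `2·c ≤ ε·γ_lo²`. -/
theorem hc : 2 * ((cQ : ℚ) : ℝ) ≤ cert.ε * (((97 / 200 : ℚ)) : ℝ) ^ 2 := by
  show 2 * ((cQ : ℚ) : ℝ) ≤ ((epsQ : ℚ) : ℝ) * (((97 / 200 : ℚ)) : ℝ) ^ 2
  exact_mod_cast two_cQ_le

/-! ### The canary sentence -/

/-- **«G2.b-SP9-SLAB» (CANARY, NOT OF RECORD) — the certified region of the structure-preserving WSCC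
3-machine model relative to bus 9 with the DECLARED damping `D`.** For every phase point `y = (δ, ω)` of
MODEL M′_D = `(WSCC9SP.params D).phaseField` whose 8 listed line-angle deviations satisfy
`|σ_e − σ*_e| ≤ 97/200` and whose relative state has `V(relState y) ≤ cQ = 366951/655360000`
(`V = xᵀPx + 2Σ λ_e∫F_e`, the slab Lyapunov function of `cert`): a solution from `y` exists (unique by
`phaseSolution_unique`) and EVERY solution keeps `|σ_e(t) − σ*_e| < 2·atan(1/4)` and `V ≤ cQ` for all
`t ≥ 0`, every bus-angle difference `δ_v − δ_w → δ*_v − δ*_w`, and every machine frequency deviation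
`ω_v → 0`. CERTIFIED for MODEL M′_D, CLASS = slab `u = 1/4` (γ ≈ 28.07°), `γ_lo = 97/200`, level `cQ`;
MODELLED «MV-3 + lossless + MV-RD(0.046 @ slack G1) + D⟨declared: MV-SPD transplant machines, buses
1/10 synthetic⟩ + V-frozen(V1) + ω_R printed + ref bus 9; canary NOT of record»; VALIDATED: the SDP
and the region-size datum. Nothing here says the WSCC system is stable.
[cite: Pai1981, §2.16 Theorem [18] and §4.6–§4.7; VuTuritsyn2017, §4.3 Theorem 1] -/
theorem sp9_slab_roa {y : (Fin 9 → ℝ) × (Fin 9 → ℝ)}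
    (hy : ∀ e, |(y.1 (srcV e) - y.1 (tgtV e)) - (δ₀ (srcV e) - δ₀ (tgtV e))| ≤ ((97 / 200 : ℚ) : ℝ))
    (hyc : cert.V (relState ref gnode δ₀ y) ≤ ((cQ : ℚ) : ℝ)) :
    (∃ X : ℝ → (Fin 9 → ℝ) × (Fin 9 → ℝ), X 0 = y ∧
        ∀ T : ℝ, ∀ t ∈ Icc 0 T, HasDerivWithinAt X ((WSCC9SP.params D).phaseField (X t)) (Icc 0 T) t) ∧
      ∀ X : ℝ → (Fin 9 → ℝ) × (Fin 9 → ℝ), X 0 = y →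
        (∀ T : ℝ, ∀ t ∈ Icc 0 T, HasDerivWithinAt X ((WSCC9SP.params D).phaseField (X t)) (Icc 0 T) t) →
        (∀ t, 0 ≤ t →
            (∀ e, |((X t).1 (srcV e) - (X t).1 (tgtV e)) - (δ₀ (srcV e) - δ₀ (tgtV e))|
              < 2 * Real.arctan ((1 / 4 : ℚ) : ℝ)) ∧
            cert.V (relState ref gnode δ₀ (X t)) ≤ ((cQ : ℚ) : ℝ)) ∧
          (∀ v w, Tendsto (fun t => (X t).1 v - (X t).1 w) atTop (𝓝 (δ₀ v - δ₀ w))) ∧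
          ∀ v ∈ genS, Tendsto (fun t => (X t).2 v) atTop (𝓝 0) :=
  WSCC9SP.slab_roa_of_eps hD cert (u := 1 / 4) (γlo := 97 / 200) (by norm_num) (by norm_num)
    (by norm_num) (by norm_num) a_le_slabSlope one_le_b hc hy hyc

end Summit.Ventures.GridStability.Bench.WSCC9SP9Slab

end
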